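import Summits.BirchSwinnertonDyer.Rank1Residual.P2.CongruentNumberSilentEvenFiveEnclosureBase
import Literature.NumberTheory.EllipticCurves.Tian2014.CMPointSystemAmbiguousClasses
import HarnessLib

/-!
# Cell `bsd-monsky` (typer), route A: C-P2-1 on `𝒮⁻` from the LISTING aut system display ALONE — the offered corner
# (`…_of_autSystemBase_descent (hSys¹⁰)`, OFFER-M v1.12) with the two order sentences of Tian's Notations (i) struck as well

HONEST FRAMING (cell `bsd-monsky`, run/shared/lean/pub/bsd-monsky/; README §1): ONE theorem on ONE explicit infinite
family of quadratic twists of the congruent number curve at the prime `2`; not "BSD for rank ≤ 1", nothing at odd primes;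
nothing is booked by this file. The corner of record of route A (referee B ROUND 784, 2026-08-27T14:43Z) is
`congruentSilentEvenFiveBSDTwo_of_autSystemCore_descent (hSys⁹)`; the corner offered in OFFER-M v1.12 is
`congruentSilentEvenFiveBSDTwo_of_autSystemBase_descent (hSys¹⁰)`. A third derivability pass over the displayed hypothesis
(`Literature/…/Tian2014/CMPointSystemAmbiguousClasses.lean`) found two more displayed conjuncts that are kernel consequences
of the others on `𝒮⁻`: the order sentences «`[𝔭_p]² = [𝔭_q]² = 1`» of Tian's Notations (i) — the half of (i) saying that the
classes of `ϖ_p`, `ϖ_q` LIE IN `𝒜[2]` — which follow from the other half (the listing `𝒜[2] ⊆ {1, [ϖ′], [𝔭_p], [𝔭_q]}`), the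
genus-character values (iii) and the finiteness of the class group (`𝒜[2] = {1, [ϖ′], [𝔭_p], [𝔭_q]}` EXACTLY) — and proved
them; `tian2014_system_sMinus_autListing` (`hSys¹¹`) is `hSys¹⁰` without those two conjuncts, and the two facts are
EQUIVALENT in the kernel (`tian2014_system_sMinus_autBase_iff_autListing`). This file is the corner on the listing display:
`congruentSilentEvenFiveBSDTwo_of_autSystemListing_descent (hSys¹¹ : tian2014_system_sMinus_autListing)` — the `2`-Selmer
input the tree's complete `2`-descent (`#Sel⁽²⁾(E_{2pq}/ℚ) ≤ 8`, p480559), rank one the tree's first `2`-descent (p457453 /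
p458378) — with the rank axis, clause (a) and both typed forms from the same binder (proofs: one-line compositions of the
offered corner A¹⁰-desc / its rank rows, p539684, with `tian2014_system_sMinus_autBase_of_autListing`). Marks of record
untouched (the readings P `tyzPhiParam` and M5 `tyzZN` sit inside `GrossZagierAut`, displayed verbatim as before).
CONDITIONAL on the one (listing) system display; nothing asserted; the conjecture `Prop`s stay `@[conjecture]`.
[cite: Tian2014, Thm. 2.8 (J132), Def. 2.7, Prop. 2.1, p0003 L3–L5 (J119), J124–J126, §4.2 (p0022 L52–L60), Notations (i)–(iii) (J122 L41–54), Prop. 4.6 proof (p0023 L26–L28)]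
[cite: TianYuanZhang2017, Thm. 3.3 (p. 739), p. 749, J733, J741, J747, J751, Lemma 3.16 (J754)]
[cite: SilvermanAEC2009, Prop. X.1.4, Prop. X.4.9, Thm. X.4.2] [cite: Miller2011LMS, Def. 1.1 (arXiv:1010.2431 p. 3)]
[cite: Lagrange1975, §11 table p. 16-12] [cite: Monsky1990MockHeegner, p. 52 ¶2]
-/

noncomputable section

open scoped Classical

open WeierstrassCurve Literature.NumberTheory.EllipticCurves
  Literature.NumberTheory.EllipticCurves.Rank1Residual.Typed

set_option autoImplicit false

namespace Summit.BirchSwinnertonDyer.Rank1Residual.P2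

open Conjectures Literature.NumberTheory.EllipticCurves.Tian2014

/-! ## §1 C-P2-1 on `𝒮⁻` from the listing aut display ALONE -/

/-- **C-P2-1 = Theorem 1.1 on `𝒮⁻` from the LISTING aut system display `hSys¹¹` ALONE** — the offered corner
(`…_of_autSystemBase_descent (hSys¹⁰)`, OFFER-M v1.12) with the order sentences «`[𝔭_p]² = [𝔭_q]² = 1`» of Tian's Notations
(i) struck from the displayed hypothesis as well (they are kernel theorems of the listing half of (i), the genus rule (iii)
and the finiteness of the class group on `𝒮⁻`); the `2`-Selmer input is the tree's complete `2`-descent. CONDITIONAL on the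
one listing system display; nothing asserted.
[cite: Tian2014, Thm. 2.8 (J132), Def. 2.7, Prop. 2.1, p0003 L3–L5 (J119), J124–J126, Notations (i)–(iii) (J122 L41–54), Prop. 4.6 proof (p0023 L26–L28)]
[cite: TianYuanZhang2017, Thm. 3.3 (p. 739), p. 749, J733, J741, J747, J751, Lemma 3.16 (J754)]
[cite: SilvermanAEC2009, Prop. X.1.4, Prop. X.4.9, Thm. X.4.2] [cite: Miller2011LMS, Def. 1.1 (arXiv:1010.2431 p. 3)]
[cite: Monsky1990MockHeegner, p. 52 ¶2] -/
theorem congruentSilentEvenFiveBSDTwo_of_autSystemListing_descent (hSys : tian2014_system_sMinus_autListing) :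
    CongruentSilentEvenFiveBSDTwo :=
  congruentSilentEvenFiveBSDTwo_of_autSystemBase_descent (tian2014_system_sMinus_autBase_of_autListing hSys)

/-! ## §2 The rank axis and the sharper form from the listing aut display ALONE -/

/-- **C-P2-1, SHARPER (`Ш_an`-unit) FORM, from the listing aut system display ALONE** (`hSys¹¹`): clause (a) and
`#Ш_an(E_{2pq})` a `2`-adic unit on all of `𝒮⁻` with NO `2`-Selmer input (the first `2`-descent of Lagrange 1975 in the
kernel and the system's own point). CONDITIONAL; nothing asserted.
[cite: Tian2014, Def. 2.7, Prop. 2.1, p0003 L3–L5 (J119), J124–J126, Notations (i)–(iii) (J122 L41–54)]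
[cite: TianYuanZhang2017, Thm. 3.3, J733, J741, J747, J751, Lemma 3.16 (J754)] [cite: Lagrange1975, §11 table p. 16-12] -/
theorem congruentSilentEvenFiveOrdTwo_of_autSystemListing_rankDescent (hSys : tian2014_system_sMinus_autListing) :
    CongruentSilentEvenFiveOrdTwo :=
  congruentSilentEvenFiveOrdTwo_of_autSystemBase_rankDescent (tian2014_system_sMinus_autBase_of_autListing hSys)

/-- **Clause (a) on all of `𝒮⁻` from the listing aut system display alone**: `ord_{s=1} L(E_{2pq}, s) = 1`.
[cite: TianYuanZhang2017, Thm. 1.1, Thm. 3.3] [cite: Tian2014, Notations (i)–(iii) (J122 L41–54)] [cite: Lagrange1975, §11 table p. 16-12] -/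
theorem analyticRank_eq_one_of_autSystemListing_rankDescent (hSys : tian2014_system_sMinus_autListing) :
    ∀ p q : ℕ, p.Prime → q.Prime → p % 8 = 5 → q % 4 = 3 → jacobiSym p q = -1 →
      (congruentNumberCurve (2 * (p * q))).analyticRank = 1 :=
  analyticRank_eq_one_of_autSystemBase_rankDescent (tian2014_system_sMinus_autBase_of_autListing hSys)

/-- **Rank one on all of `𝒮⁻` from the listing aut system display alone.** [cite: Lagrange1975, §11 table p. 16-12]
[cite: Monsky1990MockHeegner, Thm. 5.5 (p. 62), Thm. 5.9 (1) (pp. 63–64)] [cite: Tian2014, Notations (i)–(iii) (J122 L41–54)] -/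
theorem mordellWeilRank_eq_one_of_autSystemListing_rankDescent (hSys : tian2014_system_sMinus_autListing) :
    ∀ p q : ℕ, p.Prime → q.Prime → p % 8 = 5 → q % 4 = 3 → jacobiSym p q = -1 →
      (congruentNumberCurve (2 * (p * q))).mordellWeilRank = 1 :=
  mordellWeilRank_eq_one_of_autSystemBase_rankDescent (tian2014_system_sMinus_autBase_of_autListing hSys)

/-- **Both typed forms of C-P2-1 on `𝒮⁻` from the listing aut display ALONE.** CONDITIONAL; nothing asserted.
[cite: Tian2014, Def. 2.7, Prop. 2.1, p0003 L3–L5 (J119), J124–J126, Notations (i)–(iii) (J122 L41–54)]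
[cite: TianYuanZhang2017, Thm. 3.3, J733, J741, J747, J751, Lemma 3.16 (J754)]
[cite: SilvermanAEC2009, Prop. X.1.4, Prop. X.4.9] [cite: Miller2011LMS, Def. 1.1] -/
theorem congruentSilentEvenFive_pair_of_autSystemListing_descent (hSys : tian2014_system_sMinus_autListing) :
    CongruentSilentEvenFiveOrdTwo ∧ CongruentSilentEvenFiveBSDTwo :=
  ⟨congruentSilentEvenFiveOrdTwo_of_autSystemListing_rankDescent hSys,
    congruentSilentEvenFiveBSDTwo_of_autSystemListing_descent hSys⟩

/-! ## §3 The two corners are interchangeable (the displayed facts are equivalent in the kernel) -/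

/-- **The base corner and the listing corner are the same theorem read through equivalent displays**: C-P2-1 follows from
`hSys¹⁰` iff it follows from `hSys¹¹`, because `hSys¹⁰ ⟺ hSys¹¹` (`tian2014_system_sMinus_autBase_iff_autListing`).
[cite: Tian2014, Notations (i)–(iii) (J122 L41–54)] -/
theorem autSystemBase_imp_bsdTwo_iff_autSystemListing_imp_bsdTwo :
    (tian2014_system_sMinus_autBase → CongruentSilentEvenFiveBSDTwo) ↔
      (tian2014_system_sMinus_autListing → CongruentSilentEvenFiveBSDTwo) :=
  ⟨fun h hL => h (tian2014_system_sMinus_autBase_of_autListing hL),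
    fun h hB => h (tian2014_system_sMinus_autListing_of_autBase hB)⟩

end Summit.BirchSwinnertonDyer.Rank1Residual.P2

end
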